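import Literature.Probability.LatticeModels.SpinWaveComplexStabilityTorus
import Summits.HubbardSuperconductivity.HubbardSuperconductivity.Theorems.NodalWardXYDefs
import Summits.HubbardSuperconductivity.HubbardSuperconductivity.Theorems.NodalWardXYPerturbedXYOrderFixedVolume

/-!
# `PerturbedXYOrder` (stmt-HubbardSuperconductivity-10739) — line `schwarz-inheritance`, stub `stub_twistEvenResponse`

**Twist decoupling of admissible two-current tilts, I: the symmetrised response.**  For a kernel `K`
admissible at radius `ε` (`‖K(b,b')‖ ≤ ε(1+dist)⁻⁴`), every angle configuration `θ` and every
site-dependent rotation `g` of the torus `(ℤ/Lℤ)³`,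

  `‖½ (W_K(θ + g) + W_K(θ − g)) − W_K(θ)‖ ≤ 288 ε Σ_b (1 − cos ∇_b g)`,

where `W_K(θ) = Σ_{b,b'} K(b,b') sin ∇_bθ sin ∇_{b'}θ` (`Wk`).  Per pair of bonds, with `a = ∇_bθ`,
`a' = ∇_{b'}θ`, `u = ∇_b g`, `u' = ∇_{b'} g`,
`½[sin(a+u) sin(a'+u') + sin(a−u) sin(a'−u')] − sin a sin a' = sin a sin a' (cos u cos u' − 1) + cos a cos a' sin u sin u'`
(the terms odd in `g` cancel), of modulus at most `(1 − cos u) + (1 − cos u')` because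
`|sin a sin a'| + |cos a cos a'| ≤ 1`, `0 ≤ 1 − cos u cos u' ≤ (1 − cos u) + (1 − cos u')` and
`|sin u sin u'| ≤ (sin² u + sin² u')/2 ≤ (1 − cos u) + (1 − cos u')`; the row and column sums of `‖K‖` are
`≤ 144 ε` (`row_sum_norm_le_of_admissible`, `col_sum_norm_le_of_admissible`).

So the response of an admissible tilt to a slowly varying rotation is SECOND order and bounded by
`288 ε / J ×` the rotation's own spin-wave energy `J Σ_b (1 − cos ∇_b g)` — the same constant as the relative
form bound `‖W_K‖ ≤ 288 ε Σ_b (1 − cos ∇_bθ)` (`evt_norm_Wk_le_energy`).  This is the configuration-level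
form of the infrared irrelevance of the two-CURRENT tilt, and the positive shadow of the Goldstone-pinching
refutations of the invariant long-range sources (`perturbedXYOrder_false_for_invariant_meanField_source`,
p156901; `perturbedXYOrder_false_for_invariant_relBounded_source`, p158891): there the same twists move the
source by `O(L³)` at cost `O(JL)`; here they move `W_K` by at most `288ε/J ×` their cost.
-/

noncomputable section

namespace Summit.HubbardSuperconductivity.HubbardSuperconductivity.Theorems.PerturbedXYOrder

open MeasureTheory Literature.Probability.LatticeModels
open Summit.HubbardSuperconductivity.HubbardSuperconductivity.Theses.NodalWardXY

variable {L : ℕ}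

/-! ### Per-pair trigonometry -/

/-- The symmetrised twist of a product of two sines: the terms odd in the twist cancel. -/
theorem ter_pair_identity (a a' u u' : ℝ) :
    (Real.sin (a + u) * Real.sin (a' + u') + Real.sin (a - u) * Real.sin (a' - u')) / 2 -
        Real.sin a * Real.sin a' =
      Real.sin a * Real.sin a' * (Real.cos u * Real.cos u' - 1) +
        Real.cos a * Real.cos a' * (Real.sin u * Real.sin u') := by
  simp only [Real.sin_add, Real.sin_sub]
  ring

/-- `|sin a sin a'| + |cos a cos a'| ≤ 1` (AM–GM twice and `sin² + cos² = 1`). -/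
theorem ter_abs_sin_sin_add_abs_cos_cos_le (a a' : ℝ) :
    |Real.sin a * Real.sin a'| + |Real.cos a * Real.cos a'| ≤ 1 := by
  rw [abs_mul, abs_mul]
  have h1 := two_mul_le_add_sq (|Real.sin a|) (|Real.sin a'|)
  have h2 := two_mul_le_add_sq (|Real.cos a|) (|Real.cos a'|)
  simp only [sq_abs] at h1 h2
  nlinarith [Real.sin_sq_add_cos_sq a, Real.sin_sq_add_cos_sq a']

/-- `|cos u cos u' − 1| ≤ (1 − cos u) + (1 − cos u')`. -/
theorem ter_abs_cos_cos_sub_one_le (u u' : ℝ) :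
    |Real.cos u * Real.cos u' - 1| ≤ (1 - Real.cos u) + (1 - Real.cos u') := by
  have hc : Real.cos u * Real.cos u' ≤ 1 := by
    have := abs_mul (Real.cos u) (Real.cos u')
    have h1 : |Real.cos u| * |Real.cos u'| ≤ 1 :=
      mul_le_one₀ (Real.abs_cos_le_one u) (abs_nonneg _) (Real.abs_cos_le_one u')
    exact le_trans (le_abs_self _) (this ▸ h1)
  rw [abs_of_nonpos (by linarith)]
  nlinarith [mul_nonneg (sub_nonneg.2 (Real.cos_le_one u)) (sub_nonneg.2 (Real.cos_le_one u'))]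

/-- `|sin u sin u'| ≤ (1 − cos u) + (1 − cos u')` (`sin² ≤ 2(1 − cos)`). -/
theorem ter_abs_sin_sin_le (u u' : ℝ) :
    |Real.sin u * Real.sin u'| ≤ (1 - Real.cos u) + (1 - Real.cos u') := by
  rw [abs_mul]
  have h := two_mul_le_add_sq (|Real.sin u|) (|Real.sin u'|)
  simp only [sq_abs] at h
  nlinarith [fv_sin_sq_le u, fv_sin_sq_le u', abs_nonneg (Real.sin u), abs_nonneg (Real.sin u')]

/-- **Per-pair bound**: the symmetrised twist response of `sin a sin a'` has modulus at most
`(1 − cos u) + (1 − cos u')`. -/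
theorem ter_pair_bound (a a' u u' : ℝ) :
    |Real.sin a * Real.sin a' * (Real.cos u * Real.cos u' - 1) +
        Real.cos a * Real.cos a' * (Real.sin u * Real.sin u')| ≤
      (1 - Real.cos u) + (1 - Real.cos u') := by
  set m : ℝ := (1 - Real.cos u) + (1 - Real.cos u') with hm
  have hm0 : 0 ≤ m := by
    rw [hm]; linarith [Real.cos_le_one u, Real.cos_le_one u']
  have hx := ter_abs_sin_sin_add_abs_cos_cos_le a a'
  have hp := ter_abs_cos_cos_sub_one_le u u'
  have hq := ter_abs_sin_sin_le u u'
  calc |Real.sin a * Real.sin a' * (Real.cos u * Real.cos u' - 1) +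
          Real.cos a * Real.cos a' * (Real.sin u * Real.sin u')|
      ≤ |Real.sin a * Real.sin a' * (Real.cos u * Real.cos u' - 1)| +
          |Real.cos a * Real.cos a' * (Real.sin u * Real.sin u')| := abs_add_le _ _
    _ = |Real.sin a * Real.sin a'| * |Real.cos u * Real.cos u' - 1| +
          |Real.cos a * Real.cos a'| * |Real.sin u * Real.sin u'| := by rw [abs_mul, abs_mul (Real.cos a * _)]
    _ ≤ |Real.sin a * Real.sin a'| * m + |Real.cos a * Real.cos a'| * m := by
          gcongr
    _ = (|Real.sin a * Real.sin a'| + |Real.cos a * Real.cos a'|) * m := by ring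
    _ ≤ 1 * m := mul_le_mul_of_nonneg_right hx hm0
    _ = m := one_mul m

/-! ### The currents of a twisted configuration -/

/-- The current of `θ + g` on the bond `b`: `sin(∇_bθ + ∇_b g)`. -/
theorem ter_cur_add [NeZero L] (b : Bond L) (θ g : TorusSite 3 L → ℝ) :
    cur b (θ + g) = Real.sin ((θ (b.1 + Pi.single b.2 1) - θ b.1) + (g (b.1 + Pi.single b.2 1) - g b.1)) := by
  simp only [cur, Pi.add_apply]
  congr 1
  ring

/-- The current of `θ − g` on the bond `b`: `sin(∇_bθ − ∇_b g)`. -/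
theorem ter_cur_sub [NeZero L] (b : Bond L) (θ g : TorusSite 3 L → ℝ) :
    cur b (θ - g) = Real.sin ((θ (b.1 + Pi.single b.2 1) - θ b.1) - (g (b.1 + Pi.single b.2 1) - g b.1)) := by
  simp only [cur, Pi.sub_apply]
  congr 1
  ring

/-! ### The symmetrised twist response of `W_K` -/

/-- The symmetrised twist response of `W_K` as a kernel sum of the per-pair responses. -/
theorem ter_symm_sub_eq [NeZero L] (K : Bond L → Bond L → ℂ) (θ g : TorusSite 3 L → ℝ) :
    (Wk K (θ + g) + Wk K (θ - g)) / 2 - Wk K θ =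
      ∑ b : Bond L, ∑ b' : Bond L, K b b' *
        (((cur b (θ + g) * cur b' (θ + g) + cur b (θ - g) * cur b' (θ - g)) / 2 - cur b θ * cur b' θ : ℝ) : ℂ) := by
  have hterm : ∀ b b' : Bond L,
      K b b' * (((cur b (θ + g) * cur b' (θ + g) + cur b (θ - g) * cur b' (θ - g)) / 2 - cur b θ * cur b' θ : ℝ) : ℂ) =
        K b b' * (cur b (θ + g) : ℂ) * (cur b' (θ + g) : ℂ) * (1 / 2) +
          K b b' * (cur b (θ - g) : ℂ) * (cur b' (θ - g) : ℂ) * (1 / 2) -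
            K b b' * (cur b θ : ℂ) * (cur b' θ : ℂ) := by
    intro b b'
    push_cast
    ring
  simp_rw [hterm, Finset.sum_sub_distrib, Finset.sum_add_distrib, ← Finset.sum_mul]
  unfold Wk
  ring

/-- STUB `stub_twistEvenResponse` (registered on stmt-HubbardSuperconductivity-10739, line `schwarz-inheritance`, skeleton rev 22,
lead c20): **the symmetrised twist response of an admissible tilt is bounded by `288 ε ×` the twist's spin-wave energy.**
For `K` admissible at radius `ε`, every configuration `θ` and every site-dependent rotation `g`,
`‖½(W_K(θ+g) + W_K(θ−g)) − W_K(θ)‖ ≤ 288 ε Σ_b (1 − cos ∇_b g)` (per-pair bound `ter_pair_bound`, row and column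
sums of `‖K‖` at most `144 ε`). [folklore] -/
theorem stub_twistEvenResponse : ∀ (L : ℕ) [NeZero L] (ε : ℝ) (K : Bond L → Bond L → ℂ), Admissible L ε K →
    ∀ θ g : TorusSite 3 L → ℝ,
      ‖(Wk K (θ + g) + Wk K (θ - g)) / 2 - Wk K θ‖ ≤
        288 * ε * ∑ b : Bond L, (1 - Real.cos (g (b.1 + Pi.single b.2 1) - g b.1)) := by
  intro L _ ε K hK θ g
  have hrow : ∀ b : Bond L, ∑ b', ‖K b b'‖ ≤ 144 * ε := row_sum_norm_le_of_admissible K hK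
  have hcol : ∀ b' : Bond L, ∑ b, ‖K b b'‖ ≤ 144 * ε := col_sum_norm_le_of_admissible K hK
  -- the twist cost on each bond
  set m : Bond L → ℝ := fun b => 1 - Real.cos (g (b.1 + Pi.single b.2 1) - g b.1) with hm
  -- per-pair bound on the response
  have hpair : ∀ b b' : Bond L,
      |(cur b (θ + g) * cur b' (θ + g) + cur b (θ - g) * cur b' (θ - g)) / 2 - cur b θ * cur b' θ| ≤ m b + m b' := by
    intro b b'
    rw [ter_cur_add, ter_cur_add, ter_cur_sub, ter_cur_sub]
    simp only [cur]
    rw [ter_pair_identity]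
    exact ter_pair_bound _ _ _ _
  have hterm : ∀ b b' : Bond L,
      ‖K b b' * (((cur b (θ + g) * cur b' (θ + g) + cur b (θ - g) * cur b' (θ - g)) / 2 - cur b θ * cur b' θ : ℝ) : ℂ)‖ ≤
        m b * ‖K b b'‖ + m b' * ‖K b b'‖ := by
    intro b b'
    rw [norm_mul, Complex.norm_real, Real.norm_eq_abs]
    calc ‖K b b'‖ * |(cur b (θ + g) * cur b' (θ + g) + cur b (θ - g) * cur b' (θ - g)) / 2 - cur b θ * cur b' θ|
        ≤ ‖K b b'‖ * (m b + m b') := mul_le_mul_of_nonneg_left (hpair b b') (norm_nonneg _)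
      _ = m b * ‖K b b'‖ + m b' * ‖K b b'‖ := by ring
  rw [ter_symm_sub_eq]
  calc ‖∑ b : Bond L, ∑ b' : Bond L, K b b' *
          (((cur b (θ + g) * cur b' (θ + g) + cur b (θ - g) * cur b' (θ - g)) / 2 - cur b θ * cur b' θ : ℝ) : ℂ)‖
      ≤ ∑ b : Bond L, ∑ b' : Bond L, ‖K b b' *
          (((cur b (θ + g) * cur b' (θ + g) + cur b (θ - g) * cur b' (θ - g)) / 2 - cur b θ * cur b' θ : ℝ) : ℂ)‖ :=
        (norm_sum_le _ _).trans (Finset.sum_le_sum fun b _ => norm_sum_le _ _)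
    _ ≤ ∑ b : Bond L, ∑ b' : Bond L, (m b * ‖K b b'‖ + m b' * ‖K b b'‖) := by
        gcongr with b _ b' _; exact hterm b b'
    _ = ∑ b : Bond L, m b * ∑ b' : Bond L, ‖K b b'‖ + ∑ b' : Bond L, m b' * ∑ b : Bond L, ‖K b b'‖ := by
        simp only [Finset.sum_add_distrib, Finset.mul_sum]
        congr 1
        exact Finset.sum_comm
    _ ≤ ∑ b : Bond L, m b * (144 * ε) + ∑ b' : Bond L, m b' * (144 * ε) := by
        have hm0 : ∀ b : Bond L, 0 ≤ m b := fun b => by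
          rw [hm]; exact sub_nonneg.2 (Real.cos_le_one _)
        gcongr with b _ b' _
        · exact hm0 b
        · exact hrow b
        · exact hm0 b'
        · exact hcol b'
    _ = 288 * ε * ∑ b : Bond L, m b := by rw [← Finset.sum_mul]; ring

end Summit.HubbardSuperconductivity.HubbardSuperconductivity.Theorems.PerturbedXYOrder

end
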